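import Summits.Schanuel.Schanuel.Theses.RootDecomp1B

/-!
# RootDecomp1B — the ROUND-6 cut of `NoSlackFirstFailure` is EXACT (lens-4 gen 6 «PolarAutonomy»)

Helper file for the round-5 residual `NoSlackFirstFailure` (stmt-Schanuel-29189) of route RootDecomp1B after the writer's round-6 edit
(revs 13–16, 2026-08-30T07:32Z) added `BaseFedCoupling` (stmt-Schanuel-30165) and `NoAutonomousSlackFirstFailure` (stmt-Schanuel-30166,
the new declared residual).  Content (pure logic: `Transcendental K x` is by definition `¬ IsAlgebraic K x`):
* `noSlackFirstFailure_of_autonomy` — the glue Fed → Aut → NoSlack (excluded middle on «some nonzero `v` in the ℚ-span has `e^v` or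
  `e^(iv)` algebraic over the exponential-free base ℚ(r)»);
* `baseFedCoupling_of_noSlack`, `noAutonomousSlackFirstFailure_of_noSlack` — NoSlack → each half (hypothesis weakening), hence
  `noSlackFirstFailure_iff_autonomy` — the cut is EXACT;
* pedigree: both halves follow from the round-4 residual `NoDoublyDependentFirstFailure` (stmt-Schanuel-28105) by weakening.
Port of `HOME/decomp-schanuel-lens-4/g6/prover/RootDecomp1BAutonomySplit.port.lean` by the census seat (prover role): the two LOCAL COPY
defs deleted (route constants since rev 14), moved to a Theorems namespace; this file defines nothing; no transcendence input; 0 sorry.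
-/

set_option linter.dupNamespace false

namespace Summit.Schanuel.Schanuel.Theorems.RootDecomp1BAutonomySplit

open Summit.Schanuel.Schanuel.Theses.RootDecomp1B

/-- GLUE of the round-6 split: BaseFedCoupling → NoAutonomousSlackFirstFailure → NoSlackFirstFailure (at each
tuple either some nonzero `v` in the ℚ-span has `e^v` or `e^(iv)` algebraic over ℚ(r), or none has). -/
theorem noSlackFirstFailure_of_autonomy (hF : BaseFedCoupling) (hA : NoAutonomousSlackFirstFailure) :
    NoSlackFirstFailure := by
  intro m r hr hIH hB ha hb hσ hT
  by_cases h : ∃ v ∈ Submodule.span ℚ (Set.range r), v ≠ 0 ∧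
      (IsAlgebraic ↥(IntermediateField.adjoin ℚ (Set.range (fun j => ((r j : ℝ) : ℂ)))) (Complex.exp ((v : ℝ) : ℂ)) ∨
        IsAlgebraic ↥(IntermediateField.adjoin ℚ (Set.range (fun j => ((r j : ℝ) : ℂ))))
          (Complex.exp (((v : ℝ) : ℂ) * Complex.I)))
  · exact hF m r hr hIH hB ha hb hσ h hT
  · push Not at h
    exact hA m r hr hIH hB ha hb hσ (fun v hv hv0 => h v hv hv0) hT

/-- NoSlack → BaseFedCoupling (weakening). -/
theorem baseFedCoupling_of_noSlack (h : NoSlackFirstFailure) : BaseFedCoupling :=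
  fun m r hr hIH hB ha hb hσ _ hT => h m r hr hIH hB ha hb hσ hT

/-- NoSlack → NoAutonomousSlackFirstFailure (weakening). -/
theorem noAutonomousSlackFirstFailure_of_noSlack (h : NoSlackFirstFailure) : NoAutonomousSlackFirstFailure :=
  fun m r hr hIH hB ha hb hσ _ hT => h m r hr hIH hB ha hb hσ hT

/-- EXACTNESS of the round-6 cut. -/
theorem noSlackFirstFailure_iff_autonomy :
    NoSlackFirstFailure ↔ (BaseFedCoupling ∧ NoAutonomousSlackFirstFailure) :=
  ⟨fun h => ⟨baseFedCoupling_of_noSlack h, noAutonomousSlackFirstFailure_of_noSlack h⟩,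
    fun h => noSlackFirstFailure_of_autonomy h.1 h.2⟩

/-- Pedigree, fed half: the round-4 residual DD (stmt-Schanuel-28105) gives `BaseFedCoupling`. -/
theorem baseFedCoupling_of_noDoublyDependent (h : NoDoublyDependentFirstFailure) : BaseFedCoupling :=
  fun m r hr hIH hB ha hb _ _ hT => h m r hr hIH hB ha hb hT

/-- Pedigree, autonomous half: the round-4 residual DD (stmt-Schanuel-28105) gives `NoAutonomousSlackFirstFailure`. -/
theorem noAutonomousSlackFirstFailure_of_noDoublyDependent (h : NoDoublyDependentFirstFailure) :
    NoAutonomousSlackFirstFailure :=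
  fun m r hr hIH hB ha hb _ _ hT => h m r hr hIH hB ha hb hT

end Summit.Schanuel.Schanuel.Theorems.RootDecomp1BAutonomySplit
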